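import Summits.AtomisticToContinuum.HydrodynamicLimit.Theorems.AntiMazurCoboundariesKineticWindowGronwallFramePrelim
import Summits.AtomisticToContinuum.HydrodynamicLimit.Theorems.AntiMazurCoboundariesKineticWindowGronwallKineticClassUpgrade
import HarnessLib

/-!
# Frame covariance of the kinetic input in the quadratic class, I: statements, bounds, window freezing

Crux `Summit.AtomisticToContinuum.HydrodynamicLimit.Theses.AntiMazurCoboundaries.KineticWindowGronwall`
(stmt-AtomisticToContinuum-9282), line `dlr-block-transfer` v6, REGISTERED SKELETON STUB 3a `stub_frameCovariance :
FrameCovarianceQ := KineticFluxLdDecayQuad → KineticFluxLdDecayQUniv` (lead prover, continuation c1): the quadratic-class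
kinetic LD input (`κ` before `σ`, `|g(w)| ≤ κ(1 + ‖w‖²)`; the landed `@[conjecture] KineticFluxLdDecayQuad`, byte-identical
with the skeleton's `KineticFluxLdDecayQ`) with constants depending on the frame `(a, θ, u₀)` implies the same input with
ONE threshold `σ₀` and ONE amplitude `κ` serving every frame. File 1 of 2 (statements, quadratic-class bounds on the one-body
sum, window freezing in the quadratic class = registered helper stub `stub_windowFreezingQuad : WindowFreezingQuad`, the velocity
bound along the boosted canonical flow); file 2 (`…FrameCovarianceQ.lean`) holds the core estimate and `stub_frameCovariance`.

Proof: as in the bounded class (`…KineticWindowGronwallFrameUniv.lean`: activity dummy, canonical flow a.e., velocity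
translation of the datum, Galilean boost of the canonical flow, thermal scaling), except that freezing the moving test
function now costs `η κ Σᵢ (1 + ‖wᵢ(s)‖²)`, which along the boosted canonical flow is bounded through the conserved
kinetic energy by `η κ (c₁ (N+1) + 4 θ⁻¹ Σᵢ ‖vᵢ(0)‖²)`; the velocity-dependent factor is split off by
`e^{A+B} ≤ e^{2A} + e^{2B}`: `e^{2A}` is the window moment of the observable `2g` (whence the halved universal amplitude),
`e^{2B}` is the static Gaussian quadratic moment `((1 − 16κη)^{-3/2})^{N+1}` (`lintegral_exp_quadratic_localGibbsLaw_le`),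
and `η → 0` absorbs everything in `e^{δ(N+1)}`.
-/

noncomputable section

open MeasureTheory Filter Set Topology Function
open scoped ENNReal
open Literature.MathematicalPhysics.KineticTheory Literature.Analysis.FluidPDE
open Summit.AtomisticToContinuum.HydrodynamicLimit.Theses.AntiMazurCoboundaries
open Summit.AtomisticToContinuum.HydrodynamicLimit.Theorems.KineticWindowGronwallBoost
open Summit.AtomisticToContinuum.HydrodynamicLimit.Theorems.KineticWindowGronwallKineticClass (KineticFluxLdDecayQuad)

namespace Summit.AtomisticToContinuum.HydrodynamicLimit.Theorems.KineticWindowGronwallFrame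

/-! ## §1 Statements -/

/-- **The body of the quadratic-class input at a frame and an amplitude** (the conjunction after `σ < σ₀`). -/
def FrameBodyQ (σ a θ : ℝ) (u₀ : V3) (κ : ℝ) : Prop :=
  ∀ (φ : T3 → ℝ) (g : V3 → ℝ), Continuous φ → Continuous g → (∀ x, |φ x| ≤ 1) →
    (∀ v, |g v| ≤ κ * (1 + ‖v‖ ^ 2)) → OrthogonalToCollisionInvariants g →
    ∀ δ : ℝ, 0 < δ → ∃ τ : ℝ, 0 < τ ∧ ∃ N₀ : ℕ, ∀ N : ℕ, N₀ ≤ N → ∀ Φ : TFlow σ N,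
      windowMoment σ a θ u₀ N Φ φ g τ ≤ ENNReal.ofReal (Real.exp (δ * (N + 1)))

/-- **The quadratic-class kinetic input, UNIVERSAL FRAME** (verbatim the skeleton's `KineticFluxLdDecayQUniv`, written
with `ProbClause` / `FrameBodyQ`): one `σ₀`, one `κ`, then every frame `(a, θ, u₀)`. -/
def KineticFluxLdDecayQUniv : Prop :=
  ∃ σ₀ : ℝ, 0 < σ₀ ∧ ∃ κ : ℝ, 0 < κ ∧ ∀ (a θ : ℝ) (u₀ : V3), 0 < a → 0 < θ → ∀ σ : ℝ, 0 < σ → σ < σ₀ →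
    ProbClause σ a θ u₀ ∧ FrameBodyQ σ a θ u₀ κ

/-- **THE REGISTERED STATEMENT (skeleton STUB 3a)**: frame covariance of the quadratic-class kinetic input. -/
def FrameCovarianceQ : Prop :=
  KineticFluxLdDecayQuad → KineticFluxLdDecayQUniv

/-- `KineticFluxLdDecayQuad` unfolds to the frame-wise form written with `ProbClause` / `FrameBodyQ` (definitional). -/
theorem kineticFluxLdDecayQuad_iff :
    KineticFluxLdDecayQuad ↔ ∀ (a θ : ℝ) (u₀ : V3), 0 < a → 0 < θ → ∃ σ₀ : ℝ, 0 < σ₀ ∧ ∃ κ : ℝ, 0 < κ ∧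
      ∀ σ : ℝ, 0 < σ → σ < σ₀ → ProbClause σ a θ u₀ ∧ FrameBodyQ σ a θ u₀ κ :=
  Iff.rfl

/-! ## §2 Quadratic-class bounds on the one-body sum -/

section Bounds

variable {N : ℕ}

/-- The quadratic-class one-body sum is bounded by `κ ((N+1) + θ⁻¹ Σ ‖vᵢ‖²)` (centred frame). [folklore] -/
theorem abs_obsSum_le_quad {ψ : T3 → ℝ} {g : V3 → ℝ} {κ : ℝ} (hψ : ∀ x, |ψ x| ≤ 1)
    (hg : ∀ v, |g v| ≤ κ * (1 + ‖v‖ ^ 2)) {θ : ℝ} (hθ : 0 < θ) (y : Config (N + 1) (Fin 3) T3) :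
    |obsSum ψ g θ 0 y| ≤ κ * ((N + 1) + θ⁻¹ * ∑ i, ‖(y i).2‖ ^ 2) := by
  unfold obsSum
  have hκ : 0 ≤ κ := by
    have := (abs_nonneg _).trans (hg 0)
    simpa using this
  have hsq : ∀ v : V3, ‖(Real.sqrt θ)⁻¹ • v‖ ^ 2 = θ⁻¹ * ‖v‖ ^ 2 := fun v => by
    rw [norm_smul, mul_pow, Real.norm_eq_abs, abs_inv, abs_of_nonneg (Real.sqrt_nonneg θ), inv_pow,
      Real.sq_sqrt hθ.le]
  refine (Finset.abs_sum_le_sum_abs _ _).trans ?_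
  calc ∑ i : Fin (N + 1), |ψ (y i).1 * g ((Real.sqrt θ)⁻¹ • ((y i).2 - 0))|
      ≤ ∑ i : Fin (N + 1), κ * (1 + θ⁻¹ * ‖(y i).2‖ ^ 2) := Finset.sum_le_sum fun i _ => by
        rw [abs_mul, sub_zero]
        refine (mul_le_mul (hψ _) (hg _) (abs_nonneg _) zero_le_one).trans ?_
        rw [one_mul, hsq]
    _ = κ * ((N + 1) + θ⁻¹ * ∑ i, ‖(y i).2‖ ^ 2) := by
        rw [← Finset.mul_sum, Finset.sum_add_distrib, Finset.mul_sum]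
        simp only [Finset.sum_const, Finset.card_univ, Fintype.card_fin, nsmul_eq_mul, Nat.cast_add, Nat.cast_one,
          mul_one]

/-- The displacement error of the quadratic-class one-body sum: `≤ η κ ((N+1) + θ⁻¹ Σ ‖vᵢ‖²)`. [folklore] -/
theorem abs_obsSum_sub_le_quad {ψ ψ' : T3 → ℝ} {g : V3 → ℝ} {κ η : ℝ} (hψ : ∀ x, |ψ' x - ψ x| ≤ η)
    (hg : ∀ v, |g v| ≤ κ * (1 + ‖v‖ ^ 2)) {θ : ℝ} (hθ : 0 < θ) (y : Config (N + 1) (Fin 3) T3) :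
    |obsSum ψ' g θ 0 y - obsSum ψ g θ 0 y| ≤ η * (κ * ((N + 1) + θ⁻¹ * ∑ i, ‖(y i).2‖ ^ 2)) := by
  have hη : 0 ≤ η := (abs_nonneg _).trans (hψ ((y 0).1))
  have hsq : ∀ v : V3, ‖(Real.sqrt θ)⁻¹ • v‖ ^ 2 = θ⁻¹ * ‖v‖ ^ 2 := fun v => by
    rw [norm_smul, mul_pow, Real.norm_eq_abs, abs_inv, abs_of_nonneg (Real.sqrt_nonneg θ), inv_pow,
      Real.sq_sqrt hθ.le]
  unfold obsSum
  rw [← Finset.sum_sub_distrib]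
  refine (Finset.abs_sum_le_sum_abs _ _).trans ?_
  calc ∑ i : Fin (N + 1), |ψ' (y i).1 * g ((Real.sqrt θ)⁻¹ • ((y i).2 - 0)) -
          ψ (y i).1 * g ((Real.sqrt θ)⁻¹ • ((y i).2 - 0))|
      ≤ ∑ i : Fin (N + 1), η * (κ * (1 + θ⁻¹ * ‖(y i).2‖ ^ 2)) := Finset.sum_le_sum fun i _ => by
        rw [← sub_mul, abs_mul, sub_zero]
        refine (mul_le_mul (hψ _) (hg _) (abs_nonneg _) hη).trans ?_
        rw [hsq]
    _ = η * (κ * ((N + 1) + θ⁻¹ * ∑ i, ‖(y i).2‖ ^ 2)) := by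
        rw [← Finset.mul_sum, ← Finset.mul_sum, Finset.sum_add_distrib, Finset.mul_sum]
        simp only [Finset.sum_const, Finset.card_univ, Fintype.card_fin, nsmul_eq_mul, Nat.cast_add, Nat.cast_one,
          mul_one]

end Bounds

/-! ## §3 Window freezing in the quadratic class -/

section Freezing

variable {σ : ℝ} {N : ℕ}

/-- **Window freezing, quadratic class** (every datum whose orbit is measurable in time and has a uniform-in-time bound
`B` on `Σ‖vᵢ(s)‖²` over the window): the window average of the one-body sum with the moving test function exceeds the
frozen one by at most `η κ ((N+1) + θ⁻¹ B)`. [folklore] -/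
theorem window_moving_le_static_quad (Ψ : TFlow σ N) {w : Config (N + 1) (Fin 3) T3}
    (hflow : Measurable fun s : ℝ => Ψ.flow s w) {B : ℝ} (hB : ∀ s : ℝ, ∑ i, ‖(Ψ.flow s w i).2‖ ^ 2 ≤ B)
    {φ : T3 → ℝ} {g : V3 → ℝ} (hφc : Continuous φ) (hgc : Continuous g) (hφ : ∀ x, |φ x| ≤ 1) {κ : ℝ} (hκ : 0 ≤ κ)
    (hg : ∀ v, |g v| ≤ κ * (1 + ‖v‖ ^ 2)) {θ : ℝ} (hθ : 0 < θ) (u₀ : V3) {η s₀ h : ℝ} (hh : 0 < h) (hhs : h ≤ s₀)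
    (hη0 : 0 ≤ η)
    (hη : ∀ s : ℝ, |s| ≤ s₀ → ∀ x : T3,
      |φ (x + Literature.Analysis.FunctionSpaces.Torus.proj (s • u₀)) - φ x| ≤ η) :
    h⁻¹ * (∫ s in (0 : ℝ)..h, obsSum (fun x => φ (x + Literature.Analysis.FunctionSpaces.Torus.proj (s • u₀))) g θ 0
        (Ψ.flow s w)) ≤
      h⁻¹ * (∫ s in (0 : ℝ)..h, obsSum φ g θ 0 (Ψ.flow s w)) + η * (κ * ((N + 1) + θ⁻¹ * B)) := by
  -- the uniform bound along the orbit
  set M : ℝ := κ * ((N + 1) + θ⁻¹ * B) with hM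
  have hBs : ∀ s, κ * ((N + 1) + θ⁻¹ * ∑ i, ‖(Ψ.flow s w i).2‖ ^ 2) ≤ M := fun s =>
    mul_le_mul_of_nonneg_left (add_le_add le_rfl (mul_le_mul_of_nonneg_left (hB s) (inv_nonneg.2 hθ.le))) hκ
  have hm_meas : Measurable fun s : ℝ =>
      obsSum (fun x => φ (x + Literature.Analysis.FunctionSpaces.Torus.proj (s • u₀))) g θ 0 (Ψ.flow s w) := by
    have hc : Continuous fun p : ℝ × Config (N + 1) (Fin 3) T3 =>
        obsSum (fun x => φ (x + Literature.Analysis.FunctionSpaces.Torus.proj (p.1 • u₀))) g θ 0 p.2 :=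
      continuous_obsSum_param (ψ := fun s x => φ (x + Literature.Analysis.FunctionSpaces.Torus.proj (s • u₀)))
        (hφc.comp (continuous_snd.add
          (Literature.Analysis.FunctionSpaces.Torus.continuous_proj.comp (continuous_fst.smul continuous_const))))
        hgc θ 0
    exact Measurable.comp (g := fun p : ℝ × Config (N + 1) (Fin 3) T3 =>
        obsSum (fun x => φ (x + Literature.Analysis.FunctionSpaces.Torus.proj (p.1 • u₀))) g θ 0 p.2)
      (f := fun s : ℝ => (s, Ψ.flow s w)) hc.measurable (measurable_id.prodMk hflow)
  have hst_meas : Measurable fun s : ℝ => obsSum φ g θ 0 (Ψ.flow s w) := by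
    have hc : Continuous fun p : ℝ × Config (N + 1) (Fin 3) T3 => obsSum φ g θ 0 p.2 :=
      continuous_obsSum_param (ψ := fun _ : ℝ => φ) (hφc.comp continuous_snd) hgc θ 0
    exact Measurable.comp (g := fun p : ℝ × Config (N + 1) (Fin 3) T3 => obsSum φ g θ 0 p.2)
      (f := fun s : ℝ => (s, Ψ.flow s w)) hc.measurable (measurable_id.prodMk hflow)
  have hint : ∀ f : ℝ → ℝ, Measurable f → (∀ s, |f s| ≤ M) → IntervalIntegrable f volume 0 h := by
    intro f hf hb
    rw [intervalIntegrable_iff_integrableOn_Ioc_of_le hh.le]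
    refine Measure.integrableOn_of_bounded (M := M) measure_Ioc_lt_top.ne hf.aestronglyMeasurable ?_
    exact Eventually.of_forall fun s => by rw [Real.norm_eq_abs]; exact hb s
  have hmi := hint _ hm_meas fun s =>
    (abs_obsSum_le_quad (ψ := fun x => φ (x + Literature.Analysis.FunctionSpaces.Torus.proj (s • u₀)))
      (fun x => hφ _) hg hθ _).trans (hBs s)
  have hsti := hint _ hst_meas fun s => (abs_obsSum_le_quad hφ hg hθ _).trans (hBs s)
  have hle : ∀ s ∈ Icc (0 : ℝ) h,
      obsSum (fun x => φ (x + Literature.Analysis.FunctionSpaces.Torus.proj (s • u₀))) g θ 0 (Ψ.flow s w) ≤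
        obsSum φ g θ 0 (Ψ.flow s w) + η * M := by
    intro s hs
    have hsabs : |s| ≤ s₀ := by
      rw [abs_of_nonneg hs.1]
      exact hs.2.trans hhs
    have h1 := abs_obsSum_sub_le_quad (ψ := φ)
      (ψ' := fun x => φ (x + Literature.Analysis.FunctionSpaces.Torus.proj (s • u₀))) (g := g) (hη s hsabs) hg hθ
      (Ψ.flow s w)
    have h2 := (le_abs_self _).trans (h1.trans (mul_le_mul_of_nonneg_left (hBs s) hη0))
    linarith
  have hI := intervalIntegral.integral_mono_on hh.le hmi (hsti.add intervalIntegrable_const) hle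
  rw [intervalIntegral.integral_add hsti intervalIntegrable_const, intervalIntegral.integral_const, sub_zero,
    smul_eq_mul] at hI
  have hh' : 0 < h⁻¹ := inv_pos.2 hh
  calc h⁻¹ * (∫ s in (0 : ℝ)..h,
          obsSum (fun x => φ (x + Literature.Analysis.FunctionSpaces.Torus.proj (s • u₀))) g θ 0 (Ψ.flow s w))
      ≤ h⁻¹ * ((∫ s in (0 : ℝ)..h, obsSum φ g θ 0 (Ψ.flow s w)) + h * (η * M)) :=
        mul_le_mul_of_nonneg_left hI hh'.le
    _ = h⁻¹ * (∫ s in (0 : ℝ)..h, obsSum φ g θ 0 (Ψ.flow s w)) + η * M := by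
        rw [mul_add, ← mul_assoc h⁻¹ h, inv_mul_cancel₀ hh.ne', one_mul]

/-- **The velocity bound along the boosted canonical flow** `Ψ₀ = boostReg … (−u₀)`: for every datum `w` and time `s`,
`Σ ‖vᵢ(s)‖² ≤ 4 Σ ‖vᵢ(w)‖² + 6 (N+1) ‖u₀‖²` (energy conservation of the canonical flow at the translated datum, and
`‖a − u₀‖² ≤ 2‖a‖² + 2‖u₀‖²` twice). [folklore] -/
theorem sum_norm_sq_boostReg_le (hε : 0 < hsDiameter σ N) (hε' : hsDiameter σ N < 2⁻¹) (u₀ : V3)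
    (w : Config (N + 1) (Fin 3) T3) (s : ℝ) :
    ∑ i, ‖((boostReg (d := Fin 3) hε hε' (N + 1) (-u₀)).flow s w i).2‖ ^ 2 ≤
      4 * ∑ i, ‖(w i).2‖ ^ 2 + 6 * (N + 1) * ‖u₀‖ ^ 2 := by
  have hpar : ∀ a b : V3, ‖a + b‖ ^ 2 ≤ 2 * ‖a‖ ^ 2 + 2 * ‖b‖ ^ 2 := fun a b => by
    have h1 : ‖a + b‖ ^ 2 ≤ (‖a‖ + ‖b‖) ^ 2 := pow_le_pow_left₀ (norm_nonneg _) (norm_add_le a b) 2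
    nlinarith [sq_nonneg (‖a‖ - ‖b‖)]
  set y : Config (N + 1) (Fin 3) T3 := boostAt u₀ 0 w with hy
  have hE : ∑ i, ‖(Alexander.regFlow (Torus.geometry (Fin 3)) (hsDiameter σ N) s y i).2‖ ^ 2 =
      ∑ i, ‖(y i).2‖ ^ 2 := by
    have h := Alexander.configEnergy_regFlow (G := Torus.geometry (Fin 3)) (ε := hsDiameter σ N) s y
    simp only [configEnergy] at h
    have h2 := congrArg (fun x : ℝ => 2 * x) h
    simp only [← mul_assoc] at h2
    norm_num at h2
    exact h2
  have hy2 : ∑ i, ‖(y i).2‖ ^ 2 ≤ 2 * ∑ i, ‖(w i).2‖ ^ 2 + 2 * (N + 1) * ‖u₀‖ ^ 2 := by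
    calc ∑ i, ‖(y i).2‖ ^ 2 = ∑ i, ‖(w i).2 + u₀‖ ^ 2 := by simp [hy, boostAt_apply]
      _ ≤ ∑ i, (2 * ‖(w i).2‖ ^ 2 + 2 * ‖u₀‖ ^ 2) := Finset.sum_le_sum fun i _ => hpar _ _
      _ = 2 * ∑ i, ‖(w i).2‖ ^ 2 + 2 * (N + 1) * ‖u₀‖ ^ 2 := by
          rw [Finset.sum_add_distrib, ← Finset.mul_sum]
          simp only [Finset.sum_const, Finset.card_univ, Fintype.card_fin, nsmul_eq_mul, Nat.cast_add, Nat.cast_one]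
          ring
  calc ∑ i, ‖((boostReg (d := Fin 3) hε hε' (N + 1) (-u₀)).flow s w i).2‖ ^ 2
      = ∑ i, ‖(Alexander.regFlow (Torus.geometry (Fin 3)) (hsDiameter σ N) s y i).2 + -u₀‖ ^ 2 := by
        simp only [boostReg_flow, neg_neg, boostAt_apply, hy]
    _ ≤ ∑ i, (2 * ‖(Alexander.regFlow (Torus.geometry (Fin 3)) (hsDiameter σ N) s y i).2‖ ^ 2 + 2 * ‖u₀‖ ^ 2) :=
        Finset.sum_le_sum fun i _ => (hpar _ _).trans_eq (by rw [norm_neg])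
    _ = 2 * ∑ i, ‖(Alexander.regFlow (Torus.geometry (Fin 3)) (hsDiameter σ N) s y i).2‖ ^ 2 +
          2 * (N + 1) * ‖u₀‖ ^ 2 := by
        rw [Finset.sum_add_distrib, ← Finset.mul_sum]
        simp only [Finset.sum_const, Finset.card_univ, Fintype.card_fin, nsmul_eq_mul, Nat.cast_add, Nat.cast_one]
        ring
    _ ≤ 4 * ∑ i, ‖(w i).2‖ ^ 2 + 6 * (N + 1) * ‖u₀‖ ^ 2 := by rw [hE]; nlinarith [hy2]

end Freezing

/-! ## §3b The registered helper statement of this file -/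

/-- **WINDOW FREEZING, QUADRATIC CLASS (registered helper stub `stub_windowFreezingQuad`).** Along any flow whose orbit from
`w` is measurable in time with `Σ‖vᵢ(s)‖² ≤ B` over all times, for `|φ| ≤ 1`, `|g(v)| ≤ κ(1 + ‖v‖²)` (`κ ≥ 0`), `θ > 0`, a
displacement tolerance `η ≥ 0` valid for `|s| ≤ s₀` and a window `0 < h ≤ s₀`: the window average of the one-body sum with the
moving test function exceeds the frozen one by at most `η κ ((N+1) + θ⁻¹ B)`. -/
def WindowFreezingQuad : Prop :=
  ∀ (σ : ℝ) (N : ℕ) (Ψ : TFlow σ N) (w : Config (N + 1) (Fin 3) T3), (Measurable fun s : ℝ => Ψ.flow s w) →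
    ∀ B : ℝ, (∀ s : ℝ, ∑ i, ‖(Ψ.flow s w i).2‖ ^ 2 ≤ B) →
    ∀ (φ : T3 → ℝ) (g : V3 → ℝ), Continuous φ → Continuous g → (∀ x, |φ x| ≤ 1) → ∀ κ : ℝ, 0 ≤ κ →
    (∀ v, |g v| ≤ κ * (1 + ‖v‖ ^ 2)) → ∀ θ : ℝ, 0 < θ → ∀ (u₀ : V3) (η s₀ h : ℝ), 0 < h → h ≤ s₀ → 0 ≤ η →
    (∀ s : ℝ, |s| ≤ s₀ → ∀ x : T3, |φ (x + Literature.Analysis.FunctionSpaces.Torus.proj (s • u₀)) - φ x| ≤ η) →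
    h⁻¹ * (∫ s in (0 : ℝ)..h, obsSum (fun x => φ (x + Literature.Analysis.FunctionSpaces.Torus.proj (s • u₀))) g θ 0
        (Ψ.flow s w)) ≤
      h⁻¹ * (∫ s in (0 : ℝ)..h, obsSum φ g θ 0 (Ψ.flow s w)) + η * (κ * ((N + 1) + θ⁻¹ * B))

/-- **Proved**: `stub_windowFreezingQuad` (`window_moving_le_static_quad`). [folklore] -/
theorem stub_windowFreezingQuad : WindowFreezingQuad :=
  fun _ _ Ψ _ hflow _ hB _ _ hφc hgc hφ _ hκ hg _ hθ u₀ _ _ _ hh hhs hη0 hη =>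
    window_moving_le_static_quad Ψ hflow hB hφc hgc hφ hκ hg hθ u₀ hh hhs hη0 hη

end Summit.AtomisticToContinuum.HydrodynamicLimit.Theorems.KineticWindowGronwallFrame

end
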